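import Mathlib
import HarnessLib
import Summits.Ventures.LatticeQCDFlow.Exactness.NCMCGeneralSpaceIndicatorCLT
import Summits.Ventures.LatticeQCDFlow.Exactness.NCMCGeneralSpaceRestartChainEveryStart
import Summits.Ventures.LatticeQCDFlow.Exactness.NCMCGeneralSpaceTwoSampleCLT

/-!
# The Jarzynski lane along CORRELATED starts has a central limit theorem: `√n (ΔF̂_n − ΔF) ⇒ N(0, σ²_w e^{2ΔF})` along the restart chain from EVERY initial record law, for bounded-below work

HONEST FRAMING: exact (Metropolis-corrected) sampling algorithms for lattice gauge theory;
figures of merit are autocorrelation/cost numbers at stated couplings and volumes; no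
continuum-physics claim.

Venture `LatticeQCDFlow` (cell pub-lqcd), topic `Exactness`; FANOUT row 13 (`eng-snf`, GEN-22).
NEW WORK of the cell, not a published result; no definition is introduced; nothing is cited as a
fact.  GEN-16/17/18 typed the engine's default (Jarzynski) lane with CORRELATED starts — the records
`ω₀, ω₁, …` launched off ONE equilibrium stream form the Markov chain with kernel
`R = (κF ∘ₖ K).comap s` (`NCMCGeneralSpaceMarkovRun`), stationary under `P_F`, ergodic and with
`ΔF̂_n → ΔF` a.s. from EVERY start when the level sampler `K` is minorised
(`NCMCGeneralSpaceRestartChainEveryStart`) — but only at the level of the law of large numbers;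
GEN-19's NOT-CLAIMED list records that "the Jarzynski weight `e^{−W}` along the restart chain is
unbounded — its CLT along correlated starts remains untyped".  For every protocol the engine runs —
coupling / defect interpolations of Wilson-type actions on a COMPACT gauge group over a finite
lattice, with or without stochastic (heat-bath / over-relaxation) layers — the work is a finite sum
of differences of bounded actions and is therefore BOUNDED; this file types the CLT under exactly
that hypothesis, `−B ≤ W` (so `0 < e^{−W} ≤ e^{B}`).  Since the restart kernel is minorised in ONE
step by `κF ∘ₘ m` (`CrooksPair.restartKernel_nHit_one_minorised`), GEN-19's Markov-chain CLT under
a Doeblin power from every initial law (`tendstoInDistribution_timeAverage_of_nHit`,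
`NCMCGeneralSpaceDoeblinPowerCLT`) applies verbatim to the record chain; GEN-12's generic delta
method for `log` along any estimator sequence (`tendstoInDistribution_sqrt_mul_log_sub`,
`NCMCGeneralSpaceTwoSampleCLT`) and GEN-18's every-start strong law
(`CrooksPair.tendsto_sampleMean_restartChain_anyLaw`) turn it into the CLT of `ΔF̂_n`.

## Content (Crooks pair between finite weights, `Z₀ ≠ 0`; `K` Markov, `ν₀`-invariant, `m ≤ K(z, ·)`
## for all `z`, `m` finite non-zero; `R = (κF ∘ₖ K).comap s`; `P_F = fwdPathLaw ν₀ κF`;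
## `P_{μ₀}` = row 8's chain law of `R` from the initial RECORD law `μ₀`)

* **`CrooksPair.tendstoInDistribution_timeAverage_restartChain`** — for EVERY bounded measurable
  observable `g` of a record (`|g| ≤ C`) and EVERY initial record law `μ₀`:
  `(√n)⁻¹ Σ_{i<n} (g(ω_i) − E_F g) ⇒ N(0, σ²_g)` under `P_{μ₀}`, with
  `σ²_g = ∫ ḡ² dP_F + 2 Σ_{k≥0} ∫ ḡ · R^{k+1} ḡ dP_F` (`ḡ = g − E_F g`; row 8's Green–Kubo form).
* **`CrooksPair.tendstoInDistribution_sampleMean_exp_neg_work_restartChain`** — `−B ≤ W`: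
  `√n (Ȳ_n − Z₁/Z₀) ⇒ N(0, σ²_w)`, `Ȳ_n = (1/n) Σ_{i<n} e^{−W(ω_i)}`, `σ²_w = σ²_g` at `g = e^{−W}`.
* **`CrooksPair.tendstoInDistribution_jarzynskiEstimate_restartChain`** — `−B ≤ W`,
  `e^{−ΔF} = Z₁/Z₀`: `√n (ΔF̂_n − ΔF) ⇒ N(0, σ²_w / (Z₁/Z₀)²)` from EVERY initial record law, and
  **`CrooksPair.tendstoInDistribution_jarzynskiEstimate_restartChain_everyStart`** — the engine's
  form: first record launched from ANY configuration `x` (`μ₀ = κF x`), then `K` between launches.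

Reading (value-free): the honest large-`n` error bar of `dF` from `n` correlated launches is
`√(σ²_w e^{2ΔF}/n)` with `σ²_w` the Green–Kubo (integrated-autocovariance) variance of the weights
along THIS chain — `2 τ_int(ρ_w)` times the independent-launch figure `(1/ESS_F − 1)/n` of GEN-12
whenever `Var_F e^{−W} > 0`.  NOT CLAIMED: unbounded work; `σ²_w > 0` (see
`NCMCGeneralSpaceRestartChainVarianceFloor`); a consistent estimator of `σ²_w` (see
`NCMCGeneralSpaceRestartChainGammaCoverage`); a rate (Berry–Esseen); anything numerical.
-/

namespace Summit.Ventures.LatticeQCDFlow.Exactness.GeneralNCMC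

open MeasureTheory ProbabilityTheory Set Filter Finset
open scoped ENNReal Topology

variable {Ω E : Type*} [MeasurableSpace Ω] [MeasurableSpace E]

namespace CrooksPair

variable {ν₀ ν₁ : Measure Ω} [IsFiniteMeasure ν₀] [IsFiniteMeasure ν₁] {κF κR : Kernel Ω E}
  [IsMarkovKernel κF] [IsMarkovKernel κR] {s e : E → Ω} {W : E → ℝ}

/-! ## §1 The CLT for time averages of bounded record observables along the restart chain -/

omit [IsFiniteMeasure ν₁] [IsMarkovKernel κR] in
/-- **THE CLT ALONG THE RESTART CHAIN, ANY BOUNDED RECORD OBSERVABLE, ANY INITIAL RECORD LAW.**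
Crooks pair with `Z₀ ≠ 0`; `K` Markov, `ν₀`-invariant, `m ≤ K(z, ·)` for all `z` (`m` finite,
`m(Ω) ≠ 0`); `g` measurable with `|g| ≤ C`; `μ₀` ANY initial record law.  For every real random
variable `Y` with law `N(0, σ²_g)`,
`σ²_g = ∫ ḡ² dP_F + 2 Σ_{k≥0} ∫ ḡ · (kop R)^[k+1] ḡ dP_F` (`ḡ = g − ∫ g dP_F`, `R = (κF ∘ₖ K).comap s`):
`(√n)⁻¹ Σ_{i<n} (g(ω_i) − ∫ g dP_F) ⇒ Y` under the chain law of `R` from `μ₀`. -/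
theorem tendstoInDistribution_timeAverage_restartChain (K : Kernel Ω Ω) [IsMarkovKernel K]
    (h0 : ν₀ univ ≠ 0) (hK : Kernel.Invariant K ν₀) (h : CrooksPair ν₀ ν₁ κF κR s e W)
    {m : Measure Ω} [IsFiniteMeasure m] (hm0 : m univ ≠ 0) (hmin : ∀ z, m ≤ K z)
    {g : E → ℝ} (hg : Measurable g) {C : ℝ} (hC : ∀ ω, |g ω| ≤ C)
    (μ₀ : Measure E) [IsProbabilityMeasure μ₀]
    {Ω' : Type*} [MeasurableSpace Ω'] {P' : Measure Ω'} [IsProbabilityMeasure P'] {Y : Ω' → ℝ}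
    (hY : HasLaw Y (gaussianReal 0 (Real.toNNReal
      ((∫ ω, (g ω - ∫ z, g z ∂(fwdPathLaw ν₀ κF)) ^ 2 ∂(fwdPathLaw ν₀ κF))
      + 2 * ∑' k, ∫ ω, (g ω - ∫ z, g z ∂(fwdPathLaw ν₀ κF))
        * (Scoring.kop ((κF ∘ₖ K).comap s h.measurable_s))^[k + 1]
            (fun ω => g ω - ∫ z, g z ∂(fwdPathLaw ν₀ κF)) ω ∂(fwdPathLaw ν₀ κF)))) P')
    [IsProbabilityMeasure (Kernel.trajMeasure (X := fun _ : ℕ => E) μ₀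
        (fun n : ℕ => ((κF ∘ₖ K).comap s h.measurable_s).comap
          (fun hh : (j : ↥(Finset.Iic n)) → E => hh ⟨n, Finset.mem_Iic.2 le_rfl⟩)
          (measurable_pi_apply _)))] :
    TendstoInDistribution (fun (n : ℕ) (ω : ℕ → E) =>
        (Real.sqrt n)⁻¹ * ∑ i ∈ Finset.range n, (g (ω i) - ∫ z, g z ∂(fwdPathLaw ν₀ κF)))
      atTop Y (fun _ => Kernel.trajMeasure (X := fun _ : ℕ => E) μ₀
        (fun n : ℕ => ((κF ∘ₖ K).comap s h.measurable_s).comap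
          (fun hh : (j : ↥(Finset.Iic n)) → E => hh ⟨n, Finset.mem_Iic.2 le_rfl⟩)
          (measurable_pi_apply _))) P' := by
  haveI := isProbabilityMeasure_fwdPathLaw ν₀ h0 κF
  haveI := isProbabilityMeasure_normalised_bind_kernel κF hm0
  exact tendstoInDistribution_timeAverage_of_nHit (h.invariant_restartKernel K hK) hm0
    (restartKernel_nHit_one_minorised K h hm0 hmin) Nat.one_pos hg hC μ₀ hY

/-! ## §2 The weights `e^{−W}` -/

omit [IsFiniteMeasure ν₁] in
/-- **CLT FOR THE MEAN WEIGHT ALONG THE RESTART CHAIN.**  With `−B ≤ W`, for EVERY initial record law: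
`√n (Ȳ_n − Z₁/Z₀) ⇒ N(0, σ²_w)`, `Ȳ_n = sampleMean e^{−W} (ω_0, …, ω_{n−1})`,
`σ²_w = ∫ w̄² dP_F + 2 Σ_{k≥0} ∫ w̄ · (kop R)^[k+1] w̄ dP_F`, `w̄ = e^{−W} − Z₁/Z₀`. -/
theorem tendstoInDistribution_sampleMean_exp_neg_work_restartChain (K : Kernel Ω Ω)
    [IsMarkovKernel K] (h0 : ν₀ univ ≠ 0) (hK : Kernel.Invariant K ν₀)
    (h : CrooksPair ν₀ ν₁ κF κR s e W) {m : Measure Ω} [IsFiniteMeasure m] (hm0 : m univ ≠ 0)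
    (hmin : ∀ z, m ≤ K z) {B : ℝ} (hB : ∀ ω, -B ≤ W ω)
    (μ₀ : Measure E) [IsProbabilityMeasure μ₀]
    {Ω' : Type*} [MeasurableSpace Ω'] {P' : Measure Ω'} [IsProbabilityMeasure P'] {Y : Ω' → ℝ}
    (hY : HasLaw Y (gaussianReal 0 (Real.toNNReal
      ((∫ ω, (Real.exp (-W ω) - ((ν₀ univ)⁻¹ * ν₁ univ).toReal) ^ 2 ∂(fwdPathLaw ν₀ κF))
      + 2 * ∑' k, ∫ ω, (Real.exp (-W ω) - ((ν₀ univ)⁻¹ * ν₁ univ).toReal)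
        * (Scoring.kop ((κF ∘ₖ K).comap s h.measurable_s))^[k + 1]
            (fun ω => Real.exp (-W ω) - ((ν₀ univ)⁻¹ * ν₁ univ).toReal) ω ∂(fwdPathLaw ν₀ κF))))
      P')
    [IsProbabilityMeasure (Kernel.trajMeasure (X := fun _ : ℕ => E) μ₀
        (fun n : ℕ => ((κF ∘ₖ K).comap s h.measurable_s).comap
          (fun hh : (j : ↥(Finset.Iic n)) → E => hh ⟨n, Finset.mem_Iic.2 le_rfl⟩)
          (measurable_pi_apply _)))] :
    TendstoInDistribution (fun (n : ℕ) (ω : ℕ → E) =>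
        Real.sqrt n * (sampleMean (fun ε => Real.exp (-W ε)) (fun i : Fin n => ω i)
          - ((ν₀ univ)⁻¹ * ν₁ univ).toReal))
      atTop Y (fun _ => Kernel.trajMeasure (X := fun _ : ℕ => E) μ₀
        (fun n : ℕ => ((κF ∘ₖ K).comap s h.measurable_s).comap
          (fun hh : (j : ↥(Finset.Iic n)) → E => hh ⟨n, Finset.mem_Iic.2 le_rfl⟩)
          (measurable_pi_apply _))) P' := by
  have hθ : ∫ z, Real.exp (-W z) ∂(fwdPathLaw ν₀ κF) = ((ν₀ univ)⁻¹ * ν₁ univ).toReal :=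
    h.integral_exp_neg_work
  -- bounded-below work gives a bounded weight, `|e^{−W}| ≤ e^{B}`
  have hC : ∀ ω, |Real.exp (-W ω)| ≤ Real.exp B := fun ω => by
    rw [abs_of_pos (Real.exp_pos _)]
    exact Real.exp_le_exp.2 (by linarith [hB ω])
  have hclt := h.tendstoInDistribution_timeAverage_restartChain K h0 hK hm0 hmin
    (g := fun ε => Real.exp (-W ε)) (Real.measurable_exp.comp h.measurable_W.neg)
    hC μ₀ (P' := P') (Y := Y) (by rw [hθ]; exact hY)
  rw [hθ] at hclt
  refine hclt.congr (fun n => Eventually.of_forall fun ω => ?_) Filter.EventuallyEq.rfl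
  simp only [sampleMean]
  rw [Fin.sum_univ_eq_sum_range (fun i => Real.exp (-W (ω i))) n]
  exact (sqrt_mul_mean_sub_eq (fun i => Real.exp (-W (ω i))) _ n).symm

/-! ## §3 The free-energy estimate `ΔF̂_n = −log Ȳ_n` -/

/-- **THE CLT FOR THE JARZYNSKI ESTIMATE ALONG CORRELATED STARTS, FROM EVERY INITIAL RECORD LAW.**
Crooks pair with `Z₀ ≠ 0` and `e^{−ΔF} = Z₁/Z₀`; bounded-below work `−B ≤ W`; `K` Markov,
`ν₀`-invariant, dominating a non-zero finite measure `m` from every configuration; `μ₀` ANY initial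
record law.  For every real random variable `Y` with law `N(0, σ²_w / (Z₁/Z₀)²)`:
`√n (ΔF̂_n − ΔF) ⇒ Y` under the chain law of the records. -/
theorem tendstoInDistribution_jarzynskiEstimate_restartChain (K : Kernel Ω Ω) [IsMarkovKernel K]
    (h0 : ν₀ univ ≠ 0) (hK : Kernel.Invariant K ν₀) (h : CrooksPair ν₀ ν₁ κF κR s e W) {ΔF : ℝ}
    (hΔF : Real.exp (-ΔF) = ((ν₀ univ)⁻¹ * ν₁ univ).toReal) {m : Measure Ω} [IsFiniteMeasure m]
    (hm0 : m univ ≠ 0) (hmin : ∀ z, m ≤ K z) {B : ℝ} (hB : ∀ ω, -B ≤ W ω)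
    (μ₀ : Measure E) [IsProbabilityMeasure μ₀]
    {Ω' : Type*} [MeasurableSpace Ω'] {P' : Measure Ω'} [IsProbabilityMeasure P'] {Y : Ω' → ℝ}
    (hY : HasLaw Y (gaussianReal 0 (Real.toNNReal
      (((∫ ω, (Real.exp (-W ω) - ((ν₀ univ)⁻¹ * ν₁ univ).toReal) ^ 2 ∂(fwdPathLaw ν₀ κF))
      + 2 * ∑' k, ∫ ω, (Real.exp (-W ω) - ((ν₀ univ)⁻¹ * ν₁ univ).toReal)
        * (Scoring.kop ((κF ∘ₖ K).comap s h.measurable_s))^[k + 1]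
            (fun ω => Real.exp (-W ω) - ((ν₀ univ)⁻¹ * ν₁ univ).toReal) ω ∂(fwdPathLaw ν₀ κF))
        / ((ν₀ univ)⁻¹ * ν₁ univ).toReal ^ 2))) P')
    [IsProbabilityMeasure (Kernel.trajMeasure (X := fun _ : ℕ => E) μ₀
        (fun n : ℕ => ((κF ∘ₖ K).comap s h.measurable_s).comap
          (fun hh : (j : ↥(Finset.Iic n)) → E => hh ⟨n, Finset.mem_Iic.2 le_rfl⟩)
          (measurable_pi_apply _)))] :
    TendstoInDistribution (fun (n : ℕ) (ω : ℕ → E) =>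
        Real.sqrt n * (jarzynskiEstimate (fun ε => Real.exp (-W ε)) (fun i : Fin n => ω i) - ΔF))
      atTop Y (fun _ => Kernel.trajMeasure (X := fun _ : ℕ => E) μ₀
        (fun n : ℕ => ((κF ∘ₖ K).comap s h.measurable_s).comap
          (fun hh : (j : ↥(Finset.Iic n)) → E => hh ⟨n, Finset.mem_Iic.2 le_rfl⟩)
          (measurable_pi_apply _))) P' := by
  set P := Kernel.trajMeasure (X := fun _ : ℕ => E) μ₀
    (fun n : ℕ => ((κF ∘ₖ K).comap s h.measurable_s).comap
      (fun hh : (j : ↥(Finset.Iic n)) → E => hh ⟨n, Finset.mem_Iic.2 le_rfl⟩)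
      (measurable_pi_apply _)) with hP
  set θ : ℝ := ((ν₀ univ)⁻¹ * ν₁ univ).toReal with hθdef
  have hθ : 0 < θ := by rw [← hΔF]; exact Real.exp_pos _
  set σ2 : ℝ := (∫ ω, (Real.exp (-W ω) - θ) ^ 2 ∂(fwdPathLaw ν₀ κF))
      + 2 * ∑' k, ∫ ω, (Real.exp (-W ω) - θ)
        * (Scoring.kop ((κF ∘ₖ K).comap s h.measurable_s))^[k + 1]
            (fun ω => Real.exp (-W ω) - θ) ω ∂(fwdPathLaw ν₀ κF) with hσ2
  -- the variance is non-negative: it is the second moment of a martingale increment; we only need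
  -- `toNNReal`, which clips, so we argue through the CLT of §2 with `Y₀ = −θ·Y`.
  have hwm : Measurable fun ε => Real.exp (-W ε) := Real.measurable_exp.comp h.measurable_W.neg
  -- Case split on the sign of `σ2` is unnecessary: `hasLaw_const_mul_gaussianReal` needs `0 ≤ σ2`
  -- only to identify `toNNReal (σ2/θ²)·θ²` with `toNNReal σ2`; when `σ2 < 0` both clip to `0`.
  have hY₀ : HasLaw (fun ω' => -θ * Y ω') (gaussianReal 0 σ2.toNNReal) P' := by
    rcases le_or_gt 0 σ2 with hσ | hσ
    · exact hasLaw_const_mul_gaussianReal hσ hθ.ne' (neg_sq θ) hY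
    · have h1 : (σ2 / θ ^ 2).toNNReal = 0 :=
        Real.toNNReal_of_nonpos (div_nonpos_of_nonpos_of_nonneg hσ.le (sq_nonneg _))
      have h2 : σ2.toNNReal = 0 := Real.toNNReal_of_nonpos hσ.le
      rw [h1] at hY
      rw [h2]
      have h := gaussianReal_const_mul hY (-θ)
      rw [mul_zero] at h
      convert h using 2
      simp
  -- §2: CLT for the mean weight against `Y₀`
  have clt := h.tendstoInDistribution_sampleMean_exp_neg_work_restartChain K h0 hK hm0 hmin hB μ₀
    (P' := P') (Y := fun ω' => -θ * Y ω') hY₀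
  -- the strong law from every initial record law
  have hae : ∀ᵐ ω ∂P, Tendsto (fun n : ℕ =>
      sampleMean (fun ε => Real.exp (-W ε)) (fun i : Fin n => ω i)) atTop (𝓝 θ) := by
    filter_upwards [h.tendsto_sampleMean_restartChain_anyLaw K h0 hK hm0 hmin μ₀] with ω hω
    refine hω.congr fun n => ?_
    unfold sampleMean
    rw [Fin.sum_univ_eq_sum_range (fun i => Real.exp (-W (ω i))) n]
  -- the delta method for `log`
  have hlog := tendstoInDistribution_sqrt_mul_log_sub (P := P) (P' := P') hθ
    (fun n => measurable_sampleMean_run hwm n) hae clt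
  have hlim : (fun ω' => θ⁻¹ * (-θ * Y ω')) = fun ω' => -Y ω' := by
    funext ω'
    field_simp
  rw [hlim] at hlog
  -- negate: `ΔF̂_n − ΔF = −(log Ȳ_n − log θ)`
  have hneg := hlog.continuous_comp (g := fun x : ℝ => -x) continuous_neg
  have hlim2 : (fun x : ℝ => -x) ∘ (fun ω' => -Y ω') = Y := by
    funext ω'
    simp
  rw [hlim2] at hneg
  have hΔF' : ΔF = -Real.log θ := by
    rw [← hΔF, Real.log_exp, neg_neg]
  refine hneg.congr (fun n => Eventually.of_forall fun ω => ?_) Filter.EventuallyEq.rfl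
  simp only [Function.comp_apply, jarzynskiEstimate, hΔF']
  ring

/-- **THE JARZYNSKI LANE'S CLT FROM EVERY INITIAL CONFIGURATION** (the engine's form): first record
launched from ANY configuration `x` (`μ₀ = κF(x, ·)`), then `K` between launches — for every real
random variable `Y` with law `N(0, σ²_w / (Z₁/Z₀)²)`, `√n (ΔF̂_n − ΔF) ⇒ Y`. -/
theorem tendstoInDistribution_jarzynskiEstimate_restartChain_everyStart (K : Kernel Ω Ω)
    [IsMarkovKernel K] (h0 : ν₀ univ ≠ 0) (hK : Kernel.Invariant K ν₀)
    (h : CrooksPair ν₀ ν₁ κF κR s e W) {ΔF : ℝ}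
    (hΔF : Real.exp (-ΔF) = ((ν₀ univ)⁻¹ * ν₁ univ).toReal) {m : Measure Ω} [IsFiniteMeasure m]
    (hm0 : m univ ≠ 0) (hmin : ∀ z, m ≤ K z) {B : ℝ} (hB : ∀ ω, -B ≤ W ω) (x : Ω)
    {Ω' : Type*} [MeasurableSpace Ω'] {P' : Measure Ω'} [IsProbabilityMeasure P'] {Y : Ω' → ℝ}
    (hY : HasLaw Y (gaussianReal 0 (Real.toNNReal
      (((∫ ω, (Real.exp (-W ω) - ((ν₀ univ)⁻¹ * ν₁ univ).toReal) ^ 2 ∂(fwdPathLaw ν₀ κF))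
      + 2 * ∑' k, ∫ ω, (Real.exp (-W ω) - ((ν₀ univ)⁻¹ * ν₁ univ).toReal)
        * (Scoring.kop ((κF ∘ₖ K).comap s h.measurable_s))^[k + 1]
            (fun ω => Real.exp (-W ω) - ((ν₀ univ)⁻¹ * ν₁ univ).toReal) ω ∂(fwdPathLaw ν₀ κF))
        / ((ν₀ univ)⁻¹ * ν₁ univ).toReal ^ 2))) P')
    [IsProbabilityMeasure (Kernel.trajMeasure (X := fun _ : ℕ => E) (κF x)
        (fun n : ℕ => ((κF ∘ₖ K).comap s h.measurable_s).comap
          (fun hh : (j : ↥(Finset.Iic n)) → E => hh ⟨n, Finset.mem_Iic.2 le_rfl⟩)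
          (measurable_pi_apply _)))] :
    TendstoInDistribution (fun (n : ℕ) (ω : ℕ → E) =>
        Real.sqrt n * (jarzynskiEstimate (fun ε => Real.exp (-W ε)) (fun i : Fin n => ω i) - ΔF))
      atTop Y (fun _ => Kernel.trajMeasure (X := fun _ : ℕ => E) (κF x)
        (fun n : ℕ => ((κF ∘ₖ K).comap s h.measurable_s).comap
          (fun hh : (j : ↥(Finset.Iic n)) → E => hh ⟨n, Finset.mem_Iic.2 le_rfl⟩)
          (measurable_pi_apply _))) P' :=
  h.tendstoInDistribution_jarzynskiEstimate_restartChain K h0 hK hΔF hm0 hmin hB (κF x) hY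

end CrooksPair

end Summit.Ventures.LatticeQCDFlow.Exactness.GeneralNCMC

/-! ## §4 (GEN-22 append) Two printed diagnostics of the lane: the switch acceptance and the mean work have CLTs along the restart chain from every initial record law

The engine reports, next to `dF`, the mean switch acceptance `(1/n) Σ min(1, e^{−(W_i − c)})`
(estimating `a_F(c)`, GEN-10/13) and the mean work `(1/n) Σ W_i` (estimating `⟨W⟩_F`, whose excess
over `ΔF` is the dissipation, GEN-10).  Both are time averages of bounded record observables (the work
bounded on both sides for the second), so §1 gives their CLTs along correlated launches:
**`CrooksPair.tendstoInDistribution_meanAccept_restartChain`**,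
**`CrooksPair.tendstoInDistribution_meanWork_restartChain`**. -/

namespace Summit.Ventures.LatticeQCDFlow.Exactness.GeneralNCMC

open MeasureTheory ProbabilityTheory Set Filter Finset
open scoped ENNReal Topology

namespace CrooksPair

variable {Ω E : Type*} [MeasurableSpace Ω] [MeasurableSpace E]
variable {ν₀ ν₁ : Measure Ω} [IsFiniteMeasure ν₀] {κF κR : Kernel Ω E} [IsMarkovKernel κF]
  {s e : E → Ω} {W : E → ℝ}

/-- **CLT FOR THE MEAN SWITCH ACCEPTANCE ALONG THE RESTART CHAIN.**  Crooks pair with `Z₀ ≠ 0`; `K`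
Markov, `ν₀`-invariant, `m ≤ K(z, ·)` for all `z` (`m(Ω) ≠ 0`); any level constant `c`; for EVERY
initial record law and every `Y ~ N(0, σ²_a)` (`σ²_a` the Green–Kubo variance of `min(1, e^{−(W−c)})`
along `R`): `(√n)⁻¹ Σ_{i<n} (min(1, e^{−(W(ω_i)−c)}) − a_F(c)) ⇒ Y`. -/
theorem tendstoInDistribution_meanAccept_restartChain (K : Kernel Ω Ω) [IsMarkovKernel K]
    (h0 : ν₀ univ ≠ 0) (hK : Kernel.Invariant K ν₀) (h : CrooksPair ν₀ ν₁ κF κR s e W)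
    {m : Measure Ω} [IsFiniteMeasure m] (hm0 : m univ ≠ 0) (hmin : ∀ z, m ≤ K z) (c : ℝ)
    (μ₀ : Measure E) [IsProbabilityMeasure μ₀]
    {Ω' : Type*} [MeasurableSpace Ω'] {P' : Measure Ω'} [IsProbabilityMeasure P'] {Y : Ω' → ℝ}
    (hY : HasLaw Y (gaussianReal 0 (Real.toNNReal
      ((∫ ω, (min 1 (Real.exp (-(W ω - c)))
          - ∫ z, min 1 (Real.exp (-(W z - c))) ∂(fwdPathLaw ν₀ κF)) ^ 2 ∂(fwdPathLaw ν₀ κF))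
      + 2 * ∑' k, ∫ ω, (min 1 (Real.exp (-(W ω - c)))
          - ∫ z, min 1 (Real.exp (-(W z - c))) ∂(fwdPathLaw ν₀ κF))
        * (Scoring.kop ((κF ∘ₖ K).comap s h.measurable_s))^[k + 1]
            (fun ω => min 1 (Real.exp (-(W ω - c)))
              - ∫ z, min 1 (Real.exp (-(W z - c))) ∂(fwdPathLaw ν₀ κF)) ω ∂(fwdPathLaw ν₀ κF)))) P')
    [IsProbabilityMeasure (Kernel.trajMeasure (X := fun _ : ℕ => E) μ₀
        (fun n : ℕ => ((κF ∘ₖ K).comap s h.measurable_s).comap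
          (fun hh : (j : ↥(Finset.Iic n)) → E => hh ⟨n, Finset.mem_Iic.2 le_rfl⟩)
          (measurable_pi_apply _)))] :
    TendstoInDistribution (fun (n : ℕ) (ω : ℕ → E) =>
        (Real.sqrt n)⁻¹ * ∑ i ∈ Finset.range n, (min 1 (Real.exp (-(W (ω i) - c)))
          - ∫ z, min 1 (Real.exp (-(W z - c))) ∂(fwdPathLaw ν₀ κF)))
      atTop Y (fun _ => Kernel.trajMeasure (X := fun _ : ℕ => E) μ₀
        (fun n : ℕ => ((κF ∘ₖ K).comap s h.measurable_s).comap
          (fun hh : (j : ↥(Finset.Iic n)) → E => hh ⟨n, Finset.mem_Iic.2 le_rfl⟩)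
          (measurable_pi_apply _))) P' :=
  h.tendstoInDistribution_timeAverage_restartChain K h0 hK hm0 hmin
    (g := fun ω => min 1 (Real.exp (-(W ω - c))))
    (measurable_const.min (Real.measurable_exp.comp (h.measurable_W.sub measurable_const).neg))
    (C := 1) (fun ω => by
      rw [abs_of_nonneg (le_min zero_le_one (Real.exp_pos _).le)]
      exact min_le_left _ _) μ₀ hY

/-- **CLT FOR THE MEAN WORK ALONG THE RESTART CHAIN** (work bounded on both sides, `|W| ≤ B`): for
EVERY initial record law and every `Y ~ N(0, σ²_W)` (`σ²_W` the Green–Kubo variance of `W` along `R`):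
`(√n)⁻¹ Σ_{i<n} (W(ω_i) − ⟨W⟩_F) ⇒ Y`. -/
theorem tendstoInDistribution_meanWork_restartChain (K : Kernel Ω Ω) [IsMarkovKernel K]
    (h0 : ν₀ univ ≠ 0) (hK : Kernel.Invariant K ν₀) (h : CrooksPair ν₀ ν₁ κF κR s e W)
    {m : Measure Ω} [IsFiniteMeasure m] (hm0 : m univ ≠ 0) (hmin : ∀ z, m ≤ K z)
    {B : ℝ} (hB : ∀ ω, |W ω| ≤ B) (μ₀ : Measure E) [IsProbabilityMeasure μ₀]
    {Ω' : Type*} [MeasurableSpace Ω'] {P' : Measure Ω'} [IsProbabilityMeasure P'] {Y : Ω' → ℝ}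
    (hY : HasLaw Y (gaussianReal 0 (Real.toNNReal
      ((∫ ω, (W ω - ∫ z, W z ∂(fwdPathLaw ν₀ κF)) ^ 2 ∂(fwdPathLaw ν₀ κF))
      + 2 * ∑' k, ∫ ω, (W ω - ∫ z, W z ∂(fwdPathLaw ν₀ κF))
        * (Scoring.kop ((κF ∘ₖ K).comap s h.measurable_s))^[k + 1]
            (fun ω => W ω - ∫ z, W z ∂(fwdPathLaw ν₀ κF)) ω ∂(fwdPathLaw ν₀ κF)))) P')
    [IsProbabilityMeasure (Kernel.trajMeasure (X := fun _ : ℕ => E) μ₀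
        (fun n : ℕ => ((κF ∘ₖ K).comap s h.measurable_s).comap
          (fun hh : (j : ↥(Finset.Iic n)) → E => hh ⟨n, Finset.mem_Iic.2 le_rfl⟩)
          (measurable_pi_apply _)))] :
    TendstoInDistribution (fun (n : ℕ) (ω : ℕ → E) =>
        (Real.sqrt n)⁻¹ * ∑ i ∈ Finset.range n, (W (ω i) - ∫ z, W z ∂(fwdPathLaw ν₀ κF)))
      atTop Y (fun _ => Kernel.trajMeasure (X := fun _ : ℕ => E) μ₀
        (fun n : ℕ => ((κF ∘ₖ K).comap s h.measurable_s).comap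
          (fun hh : (j : ↥(Finset.Iic n)) → E => hh ⟨n, Finset.mem_Iic.2 le_rfl⟩)
          (measurable_pi_apply _))) P' :=
  h.tendstoInDistribution_timeAverage_restartChain K h0 hK hm0 hmin (g := W) h.measurable_W hB μ₀ hY

end CrooksPair

end Summit.Ventures.LatticeQCDFlow.Exactness.GeneralNCMC
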